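import Literature.AnabelianGeometry.EtaleTheta.Discharge.Sec2HcommOfSetting
import Literature.AnabelianGeometry.EtaleTheta.Discharge.Sec2Prop212OfCommutators
import Literature.AnabelianGeometry.EtaleTheta.Discharge.Sec2LiftingProofs
import Literature.AnabelianGeometry.EtaleTheta.Discharge.Sec2DtpYThetaAbelian
import HarnessLib

/-!
# [EtTh] Prop 2.12 (i)(ii), Prop 2.14 (i), Cor 2.18 (iv) (fibres) for the §1 model WITHOUT the binder
# `hYab` (proof-only corollaries of "(Δ^tp_Y)^Θ is abelian")

Mochizuki, *The étale theta function and its Frobenioid-theoretic manifestations*, Publ. RIMS **45**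
(2009) [EtTh], §1 pp. 12–13 ("abelian profinite groups `1 → Δ_Θ → (Δ^tp_Y)^Θ → (Δ^tp_Y)^ell → 1`"),
§2 Prop. 2.12 (i)(ii) p. 45, Prop. 2.14 (i) pp. 49–50, Cor. 2.18 (iv) p. 60
[cite: MochizukiEtTh2009, Prop 2.14 (i) p.49]. Layer L2 of the abc-iut cell, seat abc-iut-L2-t8 (gen 2).
PROOF-ONLY. The §2 rigidity chain for the §1 model (`EtaleThetaData.DoubleUnderline.rigidData`,
`RigidOfSetting.lean`) reached Prop. 2.12 (i) / Prop. 2.14 (i) in `Discharge/Sec2HcommOfSetting.lean`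
(seat abc-iut-L5-t14: `rigidData_hcomm`, `rigidData_prop214_i`) modulo the vacuity guard `IsEtThOrigin`
and the p. 12–13 sentence carried as TWO hypotheses `hYab` ("(Δ^tp_Y)^Θ is abelian") and `hYcl`
("(Δ^tp_Y)^Θ is profinite"). Since `hYab` is a THEOREM (`ThetaSetting.dtpYTheta_comm`,
`Discharge/Sec2DtpYThetaAbelian.lean`), this file records the same conclusions — and their formal
consequences Prop. 2.12 (i)(ii) (abc-iut-L2-t10's `prop212_i_of_hcomm` / `prop212_ii_of_commutator_subset`)
and the fibre clause of Cor. 2.18 (iv) (`cor218_iv_fibre_of_prop214_i`) — modulo `IsEtThOrigin` and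
`hYcl` ONLY (besides the adapter's standing binders `hC`, `hS`, `h15 : Prop15iii`, `L`). One-line bodies;
nothing of another seat is edited or restated. HONEST FRAMING: [EtTh] is refereed; the theta setting is
data quoting print, not asserted to exist; OUR kernel checks of printed reductions; `hYcl` and
`Prop15iii` are NOT discharged here; no side is taken on [IUTchIII] Cor. 3.12.
-/

noncomputable section

namespace Literature.AnabelianGeometry.EtaleTheta

open Literature.AnabelianGeometry.SemiGraphs
open scoped commutatorElement

namespace ThetaSetting

variable {p : ℕ} [Fact p.Prime] (D : ThetaSetting p)

/-- **Heisenberg surjectivity inside `Π_X`, without `hYab`**: under `IsEtThOrigin` and `hYcl`, for every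
`z₁ ∈ Δ^tp_X` over the generator of `Z` every element of `[Δ_X, Δ_X]⁻` is `ι[z₁, y] · k` with `y ∈ Δ^tp_Y`,
`k ∈ [[Δ_X,Δ_X],Δ_X]⁻` (abc-iut-L5-t14's `exists_commutator_mul_of_mem_commutatorClosure` with `hYab`
supplied by `dtpYTheta_comm`). [cite: MochizukiEtTh2009, §1 p.12] -/
theorem exists_commutator_mul_of_mem_commutatorClosure_of_origin (hO : D.IsEtThOrigin)
    (hYcl : (D.DtpY.map D.toHat.toMonoidHom).topologicalClosure ≤
      D.DtpY.map D.toHat.toMonoidHom ⊔ (⁅⁅D.DeltaHat, D.DeltaHat⁆, D.DeltaHat⁆).topologicalClosure)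
    {z₁ : D.PiTemp} (hz₁ : z₁ ∈ D.DeltaTemp) (hz₁Z : D.toZ z₁ = Multiplicative.ofAdd 1)
    {k : D.PiHat} (hk : k ∈ (⁅D.DeltaHat, D.DeltaHat⁆).topologicalClosure) :
    ∃ y ∈ D.DtpY, ∃ k₃ ∈ (⁅⁅D.DeltaHat, D.DeltaHat⁆, D.DeltaHat⁆).topologicalClosure,
      k = D.toHat.toMonoidHom (z₁ * y * z₁⁻¹ * y⁻¹) * k₃ :=
  D.exists_commutator_mul_of_mem_commutatorClosure (D.dtpYTheta_comm hO) hYcl hz₁ hz₁Z hk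

/-- **Heisenberg surjectivity of the theta group, without `hYab`**: under `IsEtThOrigin` and `hYcl`,
`y ↦ θ[z₁, y]` maps `Δ^tp_Y` ONTO `Δ_Θ` for every `z₁ ∈ Δ^tp_X` with `toZ z₁ = 1`
(abc-iut-L5-t14's `exists_commutator_of_mem_deltaTheta` with `hYab := dtpYTheta_comm`).
[cite: MochizukiEtTh2009, §1 p.12] -/
theorem exists_commutator_of_mem_deltaTheta_of_origin (hO : D.IsEtThOrigin)
    (hYcl : (D.DtpY.map D.toHat.toMonoidHom).topologicalClosure ≤
      D.DtpY.map D.toHat.toMonoidHom ⊔ (⁅⁅D.DeltaHat, D.DeltaHat⁆, D.DeltaHat⁆).topologicalClosure)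
    {z₁ : D.PiTemp} (hz₁ : z₁ ∈ D.DeltaTemp) (hz₁Z : D.toZ z₁ = Multiplicative.ofAdd 1)
    {s : D.GtpTheta} (hs : s ∈ D.DeltaTheta) :
    ∃ y ∈ D.DtpY, D.toTheta (z₁ * y * z₁⁻¹ * y⁻¹) = s :=
  D.exists_commutator_of_mem_deltaTheta (D.dtpYTheta_comm hO) hYcl hz₁ hz₁Z hs

namespace EtaleThetaData.DoubleUnderline

variable {D} {E : D.EtaleThetaData} {l : ℕ} (C : E.DoubleUnderline l) {N : ℕ+}
  (μ : D.CyclotomeMod l N)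

/-- **The `⊆` half of `hcomm` for `X̲̲`, without `hYab`** (Prop. 2.12 (i) for the §1 model): under
`IsEtThOrigin` and `hYcl`, every `t ∈ Π^tp_X̲̲` with `θ t ∈ l·Δ_Θ` is `z b z⁻¹ b⁻¹ k` with
`z ∈ Π^tp_X̲̲ ∩ Δ^tp_X`, `b ∈ Π^tp_X̲̲ ∩ Π^tp_Y ∩ Δ^tp_X`, `k ∈ Π^tp_X̲̲ ∩ Ker θ` (abc-iut-L5-t14's
`exists_commutator_of_toTheta_mem_lDeltaTheta` with `hYab := dtpYTheta_comm`).
[cite: MochizukiEtTh2009, Prop 2.12 (i) p.45] -/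
theorem exists_commutator_of_toTheta_mem_lDeltaTheta_of_origin (hO : D.IsEtThOrigin)
    (hYcl : (D.DtpY.map D.toHat.toMonoidHom).topologicalClosure ≤
      D.DtpY.map D.toHat.toMonoidHom ⊔ (⁅⁅D.DeltaHat, D.DeltaHat⁆, D.DeltaHat⁆).topologicalClosure)
    {t : D.PiTemp} (htH : t ∈ C.Huu) (ht : D.toTheta t ∈ D.lDeltaTheta l) :
    ∃ z ∈ C.Huu, ∃ b ∈ C.Huu, ∃ k ∈ C.Huu, z ∈ D.DeltaTemp ∧ b ∈ D.GtpY ∧ b ∈ D.DeltaTemp ∧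
      D.toTheta k = 1 ∧ t = z * b * z⁻¹ * b⁻¹ * k :=
  C.exists_commutator_of_toTheta_mem_lDeltaTheta hO (D.dtpYTheta_comm hO) hYcl htH ht

/-- **`hcomm` for the §1 model, without `hYab`** (Prop. 2.12 (i), p. 45; abc-iut-L2-t10's hypothesis in
its literal shape for t8's `rigidData`; abc-iut-L5-t14's `rigidData_hcomm` with `hYab := dtpYTheta_comm`).
[cite: MochizukiEtTh2009, Prop 2.12 (i) p.45] -/
theorem rigidData_hcomm_of_origin (hC : D.Compat) (hS : D.Sec2Hyps) (h15 : Prop15iii E hC)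
    (L : C.CuspLabels) (hO : D.IsEtThOrigin)
    (hYcl : (D.DtpY.map D.toHat.toMonoidHom).topologicalClosure ≤
      D.DtpY.map D.toHat.toMonoidHom ⊔ (⁅⁅D.DeltaHat, D.DeltaHat⁆, D.DeltaHat⁆).topologicalClosure) :
    ∀ t : (C.rigidData μ hC hS h15 L).PiX, t ∈ (C.rigidData μ hC hS h15 L).lDeltaTheta ↔
      ∃ z ∈ (C.rigidData μ hC hS h15 L).aug.ker,
        ∃ b ∈ (C.rigidData μ hC hS h15 L).PiY ⊓ (C.rigidData μ hC hS h15 L).aug.ker,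
          ∃ k ∈ (C.rigidData μ hC hS h15 L).thetaKer, t = z * b * z⁻¹ * b⁻¹ * k :=
  C.rigidData_hcomm μ hC hS h15 L hO (D.dtpYTheta_comm hO) hYcl

/-- **[EtTh] Prop. 2.12 (i) for the §1 model** (p. 45: "`l·Δ_Θ ⊆ [Δ^Θ_*, Δ^Θ_*]`"): the named fact
`Prop212_i` HOLDS for t8's `rigidData`, modulo `IsEtThOrigin` and `hYcl` (abc-iut-L2-t10's
`prop212_i_of_hcomm` over `rigidData_hcomm_of_origin`). [cite: MochizukiEtTh2009, Prop 2.12 (i) p.45] -/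
theorem rigidData_prop212_i_of_origin (hC : D.Compat) (hS : D.Sec2Hyps) (h15 : Prop15iii E hC)
    (L : C.CuspLabels) (hO : D.IsEtThOrigin)
    (hYcl : (D.DtpY.map D.toHat.toMonoidHom).topologicalClosure ≤
      D.DtpY.map D.toHat.toMonoidHom ⊔ (⁅⁅D.DeltaHat, D.DeltaHat⁆, D.DeltaHat⁆).topologicalClosure) :
    (C.rigidData μ hC hS h15 L).Prop212_i :=
  (C.rigidData μ hC hS h15 L).prop212_i_of_hcomm (C.rigidData_hcomm_of_origin μ hC hS h15 L hO hYcl)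

/-- **[EtTh] Prop. 2.12 (ii) for the §1 model** (p. 45: "follows formally from (i)"): `Prop212_ii` HOLDS
for t8's `rigidData`, modulo `IsEtThOrigin` and `hYcl`. [cite: MochizukiEtTh2009, Prop 2.12 (ii) p.45] -/
theorem rigidData_prop212_ii_of_origin (hC : D.Compat) (hS : D.Sec2Hyps) (h15 : Prop15iii E hC)
    (L : C.CuspLabels) (hO : D.IsEtThOrigin)
    (hYcl : (D.DtpY.map D.toHat.toMonoidHom).topologicalClosure ≤
      D.DtpY.map D.toHat.toMonoidHom ⊔ (⁅⁅D.DeltaHat, D.DeltaHat⁆, D.DeltaHat⁆).topologicalClosure) :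
    (C.rigidData μ hC hS h15 L).Prop212_ii :=
  (C.rigidData μ hC hS h15 L).prop212_ii_of_commutator_subset fun t ht =>
    (C.rigidData_hcomm_of_origin μ hC hS h15 L hO hYcl t).mp ht

/-- **[EtTh] Prop. 2.14 (i) for the §1 model, without `hYab`** (p. 49): `Prop214_i` HOLDS for t8's
`rigidData`, modulo `IsEtThOrigin` and `hYcl` only (abc-iut-L5-t14's `rigidData_prop214_i` with
`hYab := dtpYTheta_comm`; `hslim` discharged there by `galoisMLF_slim_holds`).
[cite: MochizukiEtTh2009, Prop 2.14 (i) p.49] -/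
theorem rigidData_prop214_i_of_origin (hC : D.Compat) (hS : D.Sec2Hyps) (h15 : Prop15iii E hC)
    (L : C.CuspLabels) (hO : D.IsEtThOrigin)
    (hYcl : (D.DtpY.map D.toHat.toMonoidHom).topologicalClosure ≤
      D.DtpY.map D.toHat.toMonoidHom ⊔ (⁅⁅D.DeltaHat, D.DeltaHat⁆, D.DeltaHat⁆).topologicalClosure) :
    (C.rigidData μ hC hS h15 L).Prop214_i :=
  C.rigidData_prop214_i μ hC hS h15 L hO (D.dtpYTheta_comm hO) hYcl

/-- **[EtTh] Cor. 2.18 (iv), fibre clause, for the §1 model** (p. 60: the natural map from liftings to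
Kummer classes has the printed fibres): `Cor218_iv_fibre` HOLDS for t8's `rigidData`, modulo
`IsEtThOrigin` and `hYcl` (abc-iut-L2-t10's `cor218_iv_fibre_of_prop214_i` over
`rigidData_prop214_i_of_origin`). [cite: MochizukiEtTh2009, Cor 2.18 (iv) p.60] -/
theorem rigidData_cor218_iv_fibre_of_origin (hC : D.Compat) (hS : D.Sec2Hyps) (h15 : Prop15iii E hC)
    (L : C.CuspLabels) (hO : D.IsEtThOrigin)
    (hYcl : (D.DtpY.map D.toHat.toMonoidHom).topologicalClosure ≤
      D.DtpY.map D.toHat.toMonoidHom ⊔ (⁅⁅D.DeltaHat, D.DeltaHat⁆, D.DeltaHat⁆).topologicalClosure) :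
    (C.rigidData μ hC hS h15 L).Cor218_iv_fibre :=
  (C.rigidData μ hC hS h15 L).cor218_iv_fibre_of_prop214_i
    (C.rigidData_prop214_i_of_origin μ hC hS h15 L hO hYcl)

end EtaleThetaData.DoubleUnderline

end ThetaSetting

end Literature.AnabelianGeometry.EtaleTheta

end
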